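import Literature.MathematicalPhysics.QuantumFieldTheory.BalabanImbrieJaffe1984to88.BIJ85Prop12BridgeHolder
import Literature.MathematicalPhysics.QuantumFieldTheory.BalabanImbrieJaffe1984to88.BIJ85Prop12BridgeZero
import Literature.MathematicalPhysics.QuantumFieldTheory.BalabanImbrieJaffe1984to88.BIJ85Ineq722AllTori

/-!
# `BalabanImbrieJaffe1984to88.BIJ85Prop12AllTori` — [BalabanImbrieJaffe1985] Sect. 7.2 p. 325 *"This inequality is a consequence of
Proposition 1.2 and the representation (1.103) of [6I]"*, with [6I] = [Balaban1984PropagatorsI] Prop. 1.2 (1.110)–(1.114) pp. 35–36: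
file 5 of the Prop. 1.2 FAMILY BRIDGE — **[6I] PROPOSITION 1.2 FOR p09's SECT. 7.2 TORUS CARRIERS OVER ALL TORI, HYPOTHESIS-FREE**:
`prop12Printed_allTori (d L) (ha : 0 < a) : B5.Prop12Printed (fun i : {(P, k) // P.d = d ∧ P.L = L ∧ 1 ≤ k ∧ k ≤ m + K} =>
settingOf (torusRep i.1.1 i.1.2 (deltaAData _ a)) i.1.2)` — ONE `(δ₀, O(1), O(1)(α))` for EVERY torus `T_η` of dimension `d` and block size
`L` (every volume `L^m`, every `ε = L^{−K}`) and EVERY scale; `prop12Printed_allTori_allScales`: the same with scale `0` included.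

statement-level skeleton of published theorems with citation tags; proofs where landed; nothing here is a claim about the Yang–Mills mass gap

CITATION HEADER (lean-in-tree rule).  Part of the lit-balaban TYPED SKELETON (HOME `run/shared/lean/pub/lit-balaban/`), Phase-2 proof seat p19
gen 6 (free target of the C1 fold owner r15, HOME/STATUS 2026-08-21T20:16:20Z, in the ALL-TORI form asked for by p16 g7's typing note
`BIJ85Prop12PerTower` / consumer `BIJ85Ineq722AllTori`; rows B5.Prop1.2 (proved, owner r02) → C1.Eq7.2.1-7.2.2 / C1.Eq7.2.4 / C2.Eq2.16–2.19 /
C2.Eq2.23).  Files 1–4: `BIJ85Prop12BridgeGeometry` (dictionary along `EK`), `BIJ85Prop12BridgeSup` ((1.110) `m = 0, 1`),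
`BIJ85Prop12BridgeHolder` ((1.111)), `BIJ85Prop12BridgeZero` (scale `0`, `η = 1`).

THE PRINTED TEXT (verbatim, [6I] p. 35 [PDF 19]): *"Proposition 1.2. There exists a positive constant δ₀ depending on d only, such that
|(GJ)(x)|, |(∇GJ)(x)|, |(G∇*J)(x)|, |(ΔGJ)(x)| ≤ O(1)e^{−δ₀|y−y′|}|J| (1.110) for x ∈ Δ̃(y), supp J ⊂ Δ̃(y′), with the constant O(1) depending
on d only, ‖ζ∇GJ‖_α, ‖ζG∇*J‖_α ≤ O(1)e^{−δ₀|y−y′|}(‖ζ‖_α + |ζ|)|J| (1.111) for 0 ≤ α < 1, ζ ∈ C₀^∞(Δ̃(y)), supp J ⊂ Δ̃(y′), with the constant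
O(1) depending on d and α"*; p. 33: *"independent of k, T_η, and depending on d only"*.  [BalabanImbrieJaffe1985] p. 325: *"there exists
δ > 0 and for 0 ≤ α < 1 a constant M = M(α) < ∞ such that … (7.2.2)"*.

WHAT IS PROVED (theorems only; no `def`, no Prop-valued fact, no hypothesis bundle).
* §1 **`ineq110_114_settingOf_of`** — ONE SCALE OF ONE TORUS: the tree's verbatim `B5.Ineq110_114` for p09's carrier
  `settingOf (torusRep P k (deltaAData hk a)) i` (genuine entries (1.110) `m = 0, 1` and (1.111) first — centred open cubes, `ℓ^∞/L^k`
  distances, `Gk hk a = Re Δ_a⁻¹ ∘ EK`; the other functionals of that carrier are `0`) FROM the (1.110) `m = 0, 1` and (1.111) vector entries of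
  r02's product setting `latticeSettingP12R (L^k) (Mk P k) a ·` (files 2–3), at any weaker constants `δ ≤ δ₀`, `O(1) ≥ 3^d e^{2δ₀}O(1)`,
  `O(1)(α) ≥ holderConst d O(1) δ₀ O(1)(·) α` — constants depending on `(d, C, C_α, δ₀)` ONLY, not on the torus;
* §2 **`ineq110_114_scale`** — EVERY SCALE `k ≤ m + K` OF ONE TORUS at constants depending on `(d, L, a)` only: `k ≥ 1` from the tree's
  hypothesis-free Prop. 1.2 on B5's torus family of record (`B5Prop12GHolds.prop12_famG_printed` over r02's all-tori index `TopIdx d L`,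
  whose member `⟨d, L, m+K−k, k⟩` IS `latticeSettingP12R (L^k) (Mk P k) a k` — `famG_reindex`, `rfl`), `k = 0` (`η = 1`, outside that index and
  outside print) from file 4 (`B5Local114GLattice.l2locL_le_printed` at `n = 1`: constants `constZero d a`, `delta114 d a`, volume-independent);
  `ineq110_114_scale_dim`: the same along `P.d = d`, `P.L = L`;
* §3 **`prop12Printed_allTori_allScales (d L) (ha)`** / **`prop12Printed_allTori (d L) (ha)`** — [6I] Prop. 1.2 BY ITS TREE NAME
  (`B5.Prop12Printed`) for p09's carriers over the index of ALL pairs `(P, k)`, `P.d = d`, `P.L = L`, `k ≤ m + K` (resp. `1 ≤ k ≤ m + K` —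
  literally the hypothesis `h12` of p16's `BIJ85Ineq722AllTori.ineq722_deltaA_seq_of_prop12Printed` and of every `…_of_prop12Printed` theorem of
  `BIJ85Sect72AllTori`), with NO hypothesis besides `0 < a` (for `d = 0` or inadmissible `L` the index is empty);
* §4 **ROW C1.Eq7.2.1-7.2.2 HYPOTHESIS-FREE, UNIFORMLY IN THE TORUS**: `ineq722_deltaA_seq_printed` — r15's typed `KernelData.Ineq722` with ONE
  `δ`, ONE `M(α)` for ANY sequence `n ↦ (P_n, k_n)` of tori (`P_n.d = d`, `P_n.L = L`) and scales `k_n ≤ m_n + K_n` (scale `0` allowed), for the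
  printed `H_k = G_kQ_k^*(Q_kG_kQ_k^*)⁻¹`, `G_k = Δ_a⁻¹` (p16's `ineq722_deltaA_seq` with its `Prop12Hyps` input DISCHARGED); `ineq722_deltaA_printed`:
  p09's per-tower shape `KernelData.Ineq722 (k ↦ torusKernelData P (lev k) (deltaAData _ a) …)` for every torus, every `lev`, no hypothesis.
HONEST SCOPE.  Proposition 1.2 of [6I] is PROVED in the tree for `G = Δ_a⁻¹` on every torus (r02/p37/p38/p16/b05 files; (1.114) by a
Combes–Thomas route instead of the printed random walk — see `B5CombesThomasLattice`); this file only transports it to the second typed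
encoding of the same tori used by the [BalabanImbrieJaffe1985] Sect. 7.2 files, at the cost of the displayed constants (`3^d e^{2δ₀}`,
`holderConst`).  Per-tower `∃`-forms (`B5.Prop12Printed (fun i => settingOf (torusRep P (levStd P i) …) i)` for ONE `P`) are finite
bookkeeping and already hypothesis-free by finiteness (p16 `BIJ85Prop12PerTower.prop12Printed_levStd_deltaA`); the content — constants chosen
BEFORE the torus — is the all-tori form proved here.  VALUE = every C1/C2 torus theorem «given only [6I] Prop. 1.2 over all tori» becomes a
theorem outright — NOT summit progress.  Unit `lit-balaban-p19` (literature-prover-lit-balaban-p19-g6-0), 2026-08-21.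
-/


namespace Literature.MathematicalPhysics.QuantumFieldTheory.BalabanImbrieJaffe1984to88.BIJ85Prop12AllTori

open Literature.MathematicalPhysics.QuantumFieldTheory.Balaban1983to89
open scoped BigOperators Matrix
open LatticeFieldCalculus (supDist)
open B5Prop11Plancherel (Tor fine)
open B5DeltaA169 (DeltaA)
open B5Eq117TorusCarriers (Mk EK)
open B5Prop12FieldsLattice (distSite suppInL supNormL eL h1L cutInL cutHL)
open B5SettingP12Real (LocR latticeSettingP12R)
open B5ResidualGpTorusHolds (TopIdx)
open B5Prop12GLattice (famG)
open B5Local114GLattice (delta114 delta114_pos)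
open BIJ85Ineq722ProofPart2 (settingOf cubeSup cubeSupG holderS holderG smulG prop12Hyps_of_ineq110_114)
open BIJ85Sect7Statements (KernelData)
open BIJ85Ineq722Torus (torusRep ctr torusKernelData)
open BIJ85Ineq722DeltaA (Gk DGk deltaAData)
open BIJ85Prop12BridgeGeometry BIJ85Prop12BridgeSup BIJ85Prop12BridgeHolder BIJ85Prop12BridgeZero

noncomputable section

variable {P : Params}

/-! ## §1  One scale: `Ineq110_114` for p09's carrier from the product entries -/

section OneScale

/-- decay weakening: `C e^{−δ₀ D} ≤ C′ e^{−δ D}` for `δ ≤ δ₀`, `C ≤ C′`, `0 ≤ C′`, `D ≥ 0`. [folklore] -/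
private theorem weaken {C C' δ₀ δ D X : ℝ} (hCC : C ≤ C') (hC' : 0 ≤ C') (hδ : δ ≤ δ₀) (hD : 0 ≤ D) (hX : 0 ≤ X) :
    C * Real.exp (-(δ₀ * D)) * X ≤ C' * Real.exp (-(δ * D)) * X := by
  have h1 : Real.exp (-(δ₀ * D)) ≤ Real.exp (-(δ * D)) := Real.exp_le_exp.mpr (by nlinarith)
  have h2 : C * Real.exp (-(δ₀ * D)) ≤ C' * Real.exp (-(δ * D)) :=
    (mul_le_mul_of_nonneg_right hCC (Real.exp_pos _).le).trans (mul_le_mul_of_nonneg_left h1 hC')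
  exact mul_le_mul_of_nonneg_right h2 hX

/-- **ONE SCALE OF THE BRIDGE**: the tree's verbatim `B5.Ineq110_114` for p09's carrier `settingOf (torusRep P k (deltaAData hk a)) i` at constants
`(C′, Cα′, 0, 0, δ)`, FROM the (1.110) entries `m = 0, 1` (`hE0`, `hE1`, constants `(C, δ₀)`) and the first (1.111) entry for real vector
sources (`hH1`, `Cα`) of the product setting on `Tor (fine (L^k) (Mk P k))`, whenever `δ ≤ δ₀`, `3^d e^{2δ₀}C ≤ C′` and
`holderConst d C δ₀ Cα α ≤ Cα′ α`. [cite: Balaban1984PropagatorsI, Prop. 1.2 (1.110)–(1.114) pp.35–36; BalabanImbrieJaffe1985, (7.2.1)–(7.2.2) p.325] -/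
theorem ineq110_114_settingOf_of {k : ℕ} (hk : k ≤ P.m + P.K) {a : ℝ} (i : ℕ) {C δ₀ : ℝ} {Cα : ℝ → ℝ} (hC : 0 ≤ C) (hδ : 0 ≤ δ₀)
    (hE0 : ∀ (J : LocR (P.L ^ k) (Mk P k)) (y y' : Tor (Mk P k)), suppInL (P.L ^ k) (Mk P k) J.emb y' →
      eL (P.L ^ k) (Mk P k) a 0 J.emb y ≤ C * Real.exp (-(δ₀ * distSite (Mk P k) y y')) * supNormL (P.L ^ k) (Mk P k) J.emb)
    (hE1 : ∀ (J : LocR (P.L ^ k) (Mk P k)) (y y' : Tor (Mk P k)), suppInL (P.L ^ k) (Mk P k) J.emb y' →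
      eL (P.L ^ k) (Mk P k) a 1 J.emb y ≤ C * Real.exp (-(δ₀ * distSite (Mk P k) y y')) * supNormL (P.L ^ k) (Mk P k) J.emb)
    (hH1 : ∀ (α : ℝ) (Jr : Tor (fine (P.L ^ k) (Mk P k)) × Fin P.d → ℝ) (ζ : Tor (fine (P.L ^ k) (Mk P k)) → ℝ)
      (y y' : Tor (Mk P k)), 0 ≤ α → α < 1 →
      cutInL (P.L ^ k) (Mk P k) ζ y → suppInL (P.L ^ k) (Mk P k) (LocR.vec Jr : LocR (P.L ^ k) (Mk P k)).emb y' →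
      h1L (P.L ^ k) (Mk P k) a (LocR.vec Jr : LocR (P.L ^ k) (Mk P k)).emb α ζ
        ≤ Cα α * Real.exp (-(δ₀ * distSite (Mk P k) y y')) * cutHL (P.L ^ k) (Mk P k) α ζ
          * supNormL (P.L ^ k) (Mk P k) (LocR.vec Jr : LocR (P.L ^ k) (Mk P k)).emb)
    {C' δ : ℝ} {Cα' : ℝ → ℝ} (hδle : δ ≤ δ₀) (hC' : 3 ^ P.d * Real.exp (2 * δ₀) * C ≤ C')
    (hCα' : ∀ α, holderConst P.d C δ₀ Cα α ≤ Cα' α) :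
    B5.Ineq110_114 (settingOf (torusRep P k (deltaAData hk a)) i) C' Cα' (fun _ => 0) (fun _ _ => 0) δ := by
  classical
  have hC'0 : 0 ≤ C' := le_trans (by positivity) hC'
  refine ⟨?_, ?_, ?_, ?_, ?_⟩
  · -- (1.110): n = 0, 1 genuine; n = 2, 3 void
    intro m (J : Balaban1983to89.Site P 0 × Fin P.d → ℝ) (y : Balaban1983to89.Site P k) (y' : Balaban1983to89.Site P k) hJ'
    have hJ : ∀ j : Balaban1983to89.Site P 0 × Fin P.d, J j ≠ 0 → supDist j.1 (ctr k y') < P.L ^ k :=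
      fun j hj => (mem_cube_iff_supDist_lt _ y' j.1).mp (hJ' j hj)
    have hD : (0 : ℝ) ≤ (supDist y y' : ℝ) := Nat.cast_nonneg _
    show (if m = 0 then cubeSup (torusRep P k (deltaAData hk a)) ((torusRep P k (deltaAData hk a)).G *ᵥ J) y
        else if m = 1 then cubeSupG (torusRep P k (deltaAData hk a)) ((torusRep P k (deltaAData hk a)).DG *ᵥ J) y else 0)
      ≤ C' * Real.exp (-(δ * (supDist y y' : ℝ))) * ‖J‖
    have hB0 : 0 ≤ C' * Real.exp (-(δ * (supDist y y' : ℝ))) * ‖J‖ := by positivity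
    have hw : 3 ^ P.d * Real.exp (2 * δ₀) * C * Real.exp (-(δ₀ * (supDist y y' : ℝ))) * ‖J‖
        ≤ C' * Real.exp (-(δ * (supDist y y' : ℝ))) * ‖J‖ := weaken hC' hC'0 hδle hD (norm_nonneg J)
    split_ifs with h0 h1
    · -- cubeSup
      refine (pi_norm_le_iff_of_nonneg hB0).2 fun j => ?_
      obtain ⟨x, μ⟩ := j
      dsimp only
      split_ifs with hx
      · rw [Real.norm_eq_abs]
        have hxc : supDist x (ctr k y) < P.L ^ k := (mem_cube_iff_supDist_lt _ y x).mp hx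
        exact (abs_Gk_mulVec_le_of_mem_cube hk a hC hδ hE0 hJ hxc μ).trans hw
      · rw [norm_zero]; exact hB0
    · -- cubeSupG
      refine (pi_norm_le_iff_of_nonneg hB0).2 fun g => ?_
      obtain ⟨x, lam, μ⟩ := g
      dsimp only
      split_ifs with hx
      · rw [Real.norm_eq_abs]
        have hxc : supDist x (ctr k y) < P.L ^ k := (mem_cube_iff_supDist_lt _ y x).mp hx
        exact (abs_DGk_mulVec_le_of_mem_cube hk a hC hδ hE1 hJ hxc lam μ).trans hw
      · rw [norm_zero]; exact hB0
    · exact hB0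
  · -- (1.111), first entry genuine
    intro α (J : Balaban1983to89.Site P 0 × Fin P.d → ℝ) (ζ : Balaban1983to89.Site P 0 → ℝ) (y : Balaban1983to89.Site P k) (y' : Balaban1983to89.Site P k) hα0 hα1 hζ' hJ'
    have hJ : ∀ j : Balaban1983to89.Site P 0 × Fin P.d, J j ≠ 0 → supDist j.1 (ctr k y') < P.L ^ k :=
      fun j hj => (mem_cube_iff_supDist_lt _ y' j.1).mp (hJ' j hj)
    have hζ : ∀ z : Balaban1983to89.Site P 0, ζ z ≠ 0 → supDist z (ctr k y) < P.L ^ k :=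
      fun z hz => (mem_cube_iff_supDist_lt _ y z).mp (hζ' z hz)
    have hD : (0 : ℝ) ≤ (supDist y y' : ℝ) := Nat.cast_nonneg _
    show holderG (torusRep P k (deltaAData hk a)) α
        (smulG (torusRep P k (deltaAData hk a)) ζ ((torusRep P k (deltaAData hk a)).DG *ᵥ J))
      ≤ Cα' α * Real.exp (-(δ * (supDist y y' : ℝ))) * (holderS (torusRep P k (deltaAData hk a)) α ζ + ‖ζ‖) * ‖J‖
    have h1 := holderG_smulG_le hk a hC hδ hα0 hα1 hE1 hH1 J ζ y y' hζ hJ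
    have hHS : 0 ≤ holderS (torusRep P k (deltaAData hk a)) α ζ := norm_nonneg _
    have hX : 0 ≤ (holderS (torusRep P k (deltaAData hk a)) α ζ + ‖ζ‖) * ‖J‖ := by positivity
    have hK0 : 0 ≤ Cα' α := (holderConst_nonneg P.d hC δ₀ Cα α).trans (hCα' α)
    have hw := weaken (hCα' α) hK0 hδle hD hX
    calc holderG (torusRep P k (deltaAData hk a)) α
          (smulG (torusRep P k (deltaAData hk a)) ζ ((torusRep P k (deltaAData hk a)).DG *ᵥ J))
        ≤ holderConst P.d C δ₀ Cα α * Real.exp (-(δ₀ * (supDist y y' : ℝ)))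
            * ((holderS (torusRep P k (deltaAData hk a)) α ζ + ‖ζ‖) * ‖J‖) := by rw [← mul_assoc]; exact h1
      _ ≤ Cα' α * Real.exp (-(δ * (supDist y y' : ℝ))) * ((holderS (torusRep P k (deltaAData hk a)) α ζ + ‖ζ‖) * ‖J‖) := hw
      _ = _ := by ring
  · -- (1.112): void functional
    intro ε (J : Balaban1983to89.Site P 0 × Fin P.d → ℝ) (y : Balaban1983to89.Site P k) (y' : Balaban1983to89.Site P k) _ _ _
    show (0 : ℝ) ≤ 0 * Real.exp (-(δ * (supDist y y' : ℝ))) * (0 + ‖J‖)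
    simp
  · -- (1.113): void functional
    intro α ε (J : Balaban1983to89.Site P 0 × Fin P.d → ℝ) (ζ : Balaban1983to89.Site P 0 → ℝ) (y : Balaban1983to89.Site P k) (y' : Balaban1983to89.Site P k) _ _ _ _ _
    show (0 : ℝ) ≤ 0 * Real.exp (-(δ * (supDist y y' : ℝ))) * (holderS (torusRep P k (deltaAData hk a)) α ζ + ‖ζ‖) * (0 + ‖J‖)
    simp
  · -- (1.114): void functional
    intro m (J : Balaban1983to89.Site P 0 × Fin P.d → ℝ) (ζ : Balaban1983to89.Site P 0 → ℝ) (y : Balaban1983to89.Site P k) (y' : Balaban1983to89.Site P k) _ _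
    show (0 : ℝ) ≤ C' * Real.exp (-(δ * (supDist y y' : ℝ))) * ‖ζ‖ * 0
    simp

end OneScale

/-! ## §2  All scales of the standing range with uniform constants -/

section AllScales

variable (P) {a : ℝ}

/-- **the member of B5's torus family of record at level `k ≥ 1`** is r02's product setting on p09's torus of scale `k`:
`famG d L a ⟨d, L, m + K − k, k⟩ = latticeSettingP12R (L^k) (Mk P k) a k` (DEFINITIONAL: `nP = L^K′`, `MP = (2L^{m′})_μ = sitesPerDir k`).
[cite: Balaban1984PropagatorsI, Prop. 1.2 p.35 («for arbitrary T_η»), (1.6) p.18] -/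
theorem famG_reindex (a : ℝ) (k : ℕ) (hk1 : 1 ≤ k) :
    famG P.d P.L a ⟨⟨P.d, P.L, P.m + P.K - k, k, P.hd, P.hL⟩, rfl, rfl, hk1⟩ = latticeSettingP12R (P.L ^ k) (Mk P k) a k := rfl

/-- **THE UNIFORM CONSTANTS AND ALL SCALES**: with `(δ₁, C₁, Cα₁)` from Proposition 1.2 on B5's torus family of record and `(delta114, constZero)`
at `η = 1`, every scale `k ≤ m + K` of p09's carrier satisfies `B5.Ineq110_114` at
`δ = min(δ₁, delta114)`, `O(1) = 3^d·max(e^{2δ₁}C₁, e^{2δ₂}constZero)`-type constants. [cite: Balaban1984PropagatorsI, Prop. 1.2 (1.110)–(1.114) pp.35–36] -/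
theorem ineq110_114_scale (ha : 0 < a) {δ₁ C₁ : ℝ} {Cα₁ Cε₁ : ℝ → ℝ} {Cαε₁ : ℝ → ℝ → ℝ} (hδ₁ : 0 < δ₁) (hC₁ : 0 < C₁)
    (H₁ : ∀ j : TopIdx P.d P.L, B5.Ineq110_114 (famG P.d P.L a j) C₁ Cα₁ Cε₁ Cαε₁ δ₁)
    (k : ℕ) (hk : k ≤ P.m + P.K) (i : ℕ) :
    B5.Ineq110_114 (settingOf (torusRep P k (deltaAData hk a)) i)
      (max (3 ^ P.d * Real.exp (2 * δ₁) * C₁) (3 ^ P.d * Real.exp (2 * delta114 P.d a) * constZero P.d a))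
      (fun α => max (holderConst P.d C₁ δ₁ Cα₁ α)
        (holderConst P.d (constZero P.d a) (delta114 P.d a) (fun _ => 2 * constZero P.d a) α))
      (fun _ => 0) (fun _ _ => 0) (min δ₁ (delta114 P.d a)) := by
  have hδ₂ : 0 < delta114 P.d a := delta114_pos P.d ha
  rcases Nat.eq_zero_or_pos k with rfl | hk1
  · -- scale 0: η = L⁰ = 1, from file 4
    have hn : P.L ^ 0 = 1 := pow_zero _
    exact ineq110_114_settingOf_of (P := P) hk i (constZero_nonneg P.d a) hδ₂.le
      (fun J y y' hJ => eL_zero_le_one (d := P.d) hn ha J y y' hJ)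
      (fun J y y' hJ => eL_one_le_one (d := P.d) hn ha J y y' hJ)
      (fun α Jr ζ y y' _ _ hζ hJ => h1L_vec_le_one (d := P.d) hn ha α Jr ζ y y' hζ hJ)
      (min_le_right _ _) (le_max_right _ _) (fun α => le_max_right _ _)
  · -- scale k ≥ 1: the member ⟨d, L, m+K−k, k⟩ of the torus family of record
    have H := H₁ ⟨⟨P.d, P.L, P.m + P.K - k, k, P.hd, P.hL⟩, rfl, rfl, hk1⟩
    rw [famG_reindex] at H
    obtain ⟨He, Hh1, -, -, -⟩ := H
    exact ineq110_114_settingOf_of (P := P) hk i hC₁.le hδ₁.le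
      (fun J y y' hJ => He 0 J y y' hJ) (fun J y y' hJ => He 1 J y y' hJ)
      (fun α Jr ζ y y' h0 h1 hζ hJ => Hh1 α (LocR.vec Jr) ζ y y' h0 h1 hζ hJ)
      (min_le_left _ _) (le_max_left _ _) (fun α => le_max_left _ _)

/-- **the constants of §2 along `P.d = d`, `P.L = L`** (so that they are chosen before the torus). [cite: Balaban1984PropagatorsI, Prop. 1.2 (1.110)–(1.114) pp.35–36] -/
theorem ineq110_114_scale_dim {d L : ℕ} (ha : 0 < a) {δ₁ C₁ : ℝ} {Cα₁ Cε₁ : ℝ → ℝ} {Cαε₁ : ℝ → ℝ → ℝ} (hδ₁ : 0 < δ₁) (hC₁ : 0 < C₁)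
    (H₁ : ∀ j : TopIdx d L, B5.Ineq110_114 (famG d L a j) C₁ Cα₁ Cε₁ Cαε₁ δ₁)
    (Q : Params) (hQd : Q.d = d) (hQL : Q.L = L) (k : ℕ) (hk : k ≤ Q.m + Q.K) (i : ℕ) :
    B5.Ineq110_114 (settingOf (torusRep Q k (deltaAData hk a)) i)
      (max (3 ^ d * Real.exp (2 * δ₁) * C₁) (3 ^ d * Real.exp (2 * delta114 d a) * constZero d a))
      (fun α => max (holderConst d C₁ δ₁ Cα₁ α) (holderConst d (constZero d a) (delta114 d a) (fun _ => 2 * constZero d a) α))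
      (fun _ => 0) (fun _ _ => 0) (min δ₁ (delta114 d a)) := by
  subst hQd; subst hQL
  exact ineq110_114_scale Q ha hδ₁ hC₁ H₁ k hk i

end AllScales

/-! ## §3  Proposition 1.2 for p09's carriers over ALL tori, hypothesis-free -/

section AllTori

variable {a : ℝ}

/-- **[6I] PROPOSITION 1.2 BY ITS TREE NAME FOR p09's SECT. 7.2 CARRIERS OF `G_k = Δ_a⁻¹` OVER ALL TORI AND ALL SCALES `0 ≤ k ≤ m + K`,
HYPOTHESIS-FREE**: ONE `δ₀ > 0`, ONE `O(1)`, ONE `O(1)(α)` such that the tree's verbatim `B5.Ineq110_114` holds for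
`settingOf (torusRep P k (deltaAData hk a)) k` for EVERY torus `P` with `P.d = d`, `P.L = L` (every volume, every `ε = L^{−K}`) and EVERY
`k ≤ m + K` — *"with the constant O(1) depending on d only … independent of k, T_η"* (scales `k ≥ 1`: the tree's Prop. 1.2 on B5's torus family
of record `B5Prop12GHolds.prop12_famG_printed`; scale `0`, `η = 1`: (1.114) at `n = 1`, file 4).
[cite: Balaban1984PropagatorsI, Prop. 1.2 (1.110)–(1.114) pp.35–36, p.39 («This completes the proof of Proposition 1.2»); BalabanImbrieJaffe1985, (7.2.2) p.325] -/
theorem prop12Printed_allTori_allScales (d L : ℕ) (ha : 0 < a) :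
    B5.Prop12Printed (fun i : {x : Params × ℕ // x.1.d = d ∧ x.1.L = L ∧ x.2 ≤ x.1.m + x.1.K} =>
      settingOf (torusRep i.1.1 i.1.2 (deltaAData i.2.2.2 a)) i.1.2) := by
  by_cases h : 1 ≤ d ∧ (Odd L ∧ 1 < L)
  · obtain ⟨δ₁, C₁, Cα₁, Cε₁, Cαε₁, hδ₁, hC₁, H₁⟩ := B5Prop12GHolds.prop12_famG_printed (d := d) (L := L) h.1 h.2 ha
    refine ⟨min δ₁ (delta114 d a), max (3 ^ d * Real.exp (2 * δ₁) * C₁) (3 ^ d * Real.exp (2 * delta114 d a) * constZero d a),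
      fun α => max (holderConst d C₁ δ₁ Cα₁ α) (holderConst d (constZero d a) (delta114 d a) (fun _ => 2 * constZero d a) α),
      fun _ => 0, fun _ _ => 0, lt_min hδ₁ (delta114_pos d ha), lt_max_of_lt_left (by positivity), fun i => ?_⟩
    exact ineq110_114_scale_dim ha hδ₁ hC₁ H₁ i.1.1 i.2.1 i.2.2.1 i.1.2 i.2.2.2 i.1.2
  · -- no torus has `d = 0` or an inadmissible `L`: the index is empty
    refine ⟨1, 1, fun _ => 0, fun _ => 0, fun _ _ => 0, one_pos, one_pos, fun i => ?_⟩
    exact (h ⟨i.2.1 ▸ i.1.1.hd, i.2.2.1 ▸ i.1.1.hL⟩).elim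

/-- **[6I] PROPOSITION 1.2 BY ITS TREE NAME OVER ALL TORI, SCALES `1 ≤ k ≤ m + K`** — literally the hypothesis `h12` of
`BIJ85Ineq722AllTori.ineq722_deltaA_seq_of_prop12Printed` / `ineq722_deltaA_lev_of_prop12Printed_allTori` and of the `…_of_prop12Printed`
theorems of `BIJ85Sect72AllTori`, DISCHARGED: for every `d`, `L` and `a > 0`, with no other hypothesis.
[cite: Balaban1984PropagatorsI, Prop. 1.2 (1.110)–(1.114) pp.35–36; BalabanImbrieJaffe1985, (7.2.2) p.325] -/
theorem prop12Printed_allTori (d L : ℕ) (ha : 0 < a) :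
    B5.Prop12Printed (fun i : {x : Params × ℕ // x.1.d = d ∧ x.1.L = L ∧ 1 ≤ x.2 ∧ x.2 ≤ x.1.m + x.1.K} =>
      settingOf (torusRep i.1.1 i.1.2 (deltaAData i.2.2.2.2 a)) i.1.2) := by
  obtain ⟨δ, C, Cα, Cε, Cαε, hδ, hC, H⟩ := prop12Printed_allTori_allScales d L ha
  exact ⟨δ, C, Cα, Cε, Cαε, hδ, hC, fun i => H ⟨i.1, i.2.1, i.2.2.1, i.2.2.2.2⟩⟩

end AllTori

/-! ## §4  Row C1.Eq7.2.1-7.2.2: (7.2.2) hypothesis-free, uniformly in the torus -/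

section Ineq722

variable {a : ℝ}

/-- **(7.2.2) HYPOTHESIS-FREE, ONE `δ`, ONE `M(α)` FOR ANY SEQUENCE OF TORI AND SCALES**: for `n ↦ (P_n, k_n)` with `P_n.d = d`, `P_n.L = L`,
`k_n ≤ m_n + K_n` (scale `0` allowed) and the printed `H_k = G_kQ_k^*(Q_kG_kQ_k^*)⁻¹`, `G_k = Δ_a⁻¹` (`deltaAData`), `a > 0`, r15's typed
`KernelData.Ineq722` holds for the sequence of p09's kernel data — p. 325 *"This inequality is a consequence of Proposition 1.2 and the
representation (1.103) of [6I]"* with NO hypothesis left: p16's `BIJ85Ineq722AllTori.ineq722_deltaA_seq` (p09's derivation re-indexed across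
tori) fed with §3.  The unit-lattice members `BondU`, `distEB`, `Cker`, `Dker` of the carrier are free, as in `BIJ85Ineq722Torus`.
[cite: BalabanImbrieJaffe1985, (7.2.2) p.325] -/
theorem ineq722_deltaA_seq_printed {d L : ℕ} (Pn : ℕ → Params) (hPd : ∀ n, (Pn n).d = d) (hPL : ∀ n, (Pn n).L = L) (kn : ℕ → ℕ)
    (hkn : ∀ n, kn n ≤ (Pn n).m + (Pn n).K) (ha : 0 < a) (BondU : ℕ → Type)
    (distEB : (n : ℕ) → Balaban1983to89.Site (Pn n) 0 → BondU n → ℝ)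
    (Cker : (n : ℕ) → Fin (Pn n).d → Fin (Pn n).d → Balaban1983to89.Site (Pn n) (kn n) → Balaban1983to89.Site (Pn n) (kn n) → ℝ)
    (Dker : (n : ℕ) → Balaban1983to89.Site (Pn n) 0 → BondU n → ℝ) :
    KernelData.Ineq722
      (fun n => torusKernelData (Pn n) (kn n) (deltaAData (hkn n) a) (BondU n) (distEB n) (Cker n) (Dker n)) := by
  obtain ⟨δ₀, C, Cα, Cε, Cαε, hδ₀, hC, hall⟩ := prop12Printed_allTori_allScales d L ha
  exact BIJ85Ineq722AllTori.ineq722_deltaA_seq Pn hPd kn hkn ha BondU distEB Cker Dker (C := C) (δ₀ := δ₀) (Cα := Cα)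
    fun n => prop12Hyps_of_ineq110_114 hC.le hδ₀ (hall ⟨(Pn n, kn n), hPd n, hPL n, hkn n⟩)

/-- **(7.2.2) HYPOTHESIS-FREE IN p09's PER-TOWER SHAPE**: for every torus `P`, every indexing `lev` of scales `lev k ≤ m + K` and every `a > 0`,
`KernelData.Ineq722 (k ↦ torusKernelData P (lev k) (deltaAData _ a) …)` — the conclusion of `BIJ85Ineq722DeltaA.ineq722_deltaA_of_prop12Printed`
with its `h12` gone (constants inside the proof chosen before the torus, §3). [cite: BalabanImbrieJaffe1985, (7.2.2) p.325] -/
theorem ineq722_deltaA_printed (P : Params) (lev : ℕ → ℕ) (hlev : ∀ k, lev k ≤ P.m + P.K) (ha : 0 < a) (BondU : ℕ → Type)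
    (distEB : (k : ℕ) → Balaban1983to89.Site P 0 → BondU k → ℝ)
    (Cker : (k : ℕ) → Fin P.d → Fin P.d → Balaban1983to89.Site P (lev k) → Balaban1983to89.Site P (lev k) → ℝ)
    (Dker : (k : ℕ) → Balaban1983to89.Site P 0 → BondU k → ℝ) :
    KernelData.Ineq722 (fun k => torusKernelData P (lev k) (deltaAData (hlev k) a) (BondU k) (distEB k) (Cker k) (Dker k)) :=
  ineq722_deltaA_seq_printed (fun _ => P) (fun _ => rfl) (fun _ => rfl) lev hlev ha BondU distEB Cker Dker

end Ineq722

end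

end Literature.MathematicalPhysics.QuantumFieldTheory.BalabanImbrieJaffe1984to88.BIJ85Prop12AllTori
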